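import Summits.ValiantsHypothesis.ValiantsHypothesis.Theorems.KPlusLogSqLawTropicalBSingleGauge

/-!
# Route «KPlusLogSqLaw», crux `TropicalB` (stmt-ValiantsHypothesis-19771) — SINGLE-GAUGE CEILING, LEVEL-MAJOR CASE:
# a `K = 4` chain certified by ONE level-major affine row gauge has `n ≤ m(m+2)` — DIAMOND is optimal for its own gauge type

HONEST FRAMING.  Helper `--supports` the crux `Summit.ValiantsHypothesis.ValiantsHypothesis.Theses.KPlusLogSqLaw.TropicalB`
(item stmt-ValiantsHypothesis-19771, route KPlusLogSqLaw, DRAFT; cell `pub-symmetroid`, seat val-sym-trop-p5 g11, 2026-08-27).  A STRUCTURE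
theorem about dominant chains of ARBITRARY `K = 4` designs that admit a column-wise certificate by one affine row gauge of LEVEL-MAJOR type;
nothing here bears on `TropicalB` in its window, `WeakLifting`, the doors, `MatrixDescartes` (stmt-ValiantsHypothesis-18050) or VP ≠ VNP.

THE POINT.  The tree's SINGLE-GAUGE LAW (`SingleGauge.chain_le_of_singleGauge`, p554764) bounds a chain certified column-wise by one affine
row gauge `u_i(θ) = α_i θ + β_i` by `n ≤ m(mK − 1)` (`= m(4m−1)` at `K = 4`).  Every all-`m` structured family of the cell (SHIFT-SQUARE,
DIAMOND, torus / rotation skeletons, gauge-circulants) is certified by a gauge of ONE special type: LEVEL-MAJOR — the gauged slopes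
`d_l − α_i` of the `4m` incidence types come in three blocks «all of class 0» < «classes 1, 2 row by row» < «all of class 3» (the gauge separates
the rows by more than the lo-gap `d₂ − d₁` and by less than the level gaps `d₁ − d₀`, `d₃ − d₂`; DIAMOND's `u_a = −κθa`, `d = (0, D, D+1, 2D)`,
`D = mκ`, `κ > 1`).  For this type the sharp value is DIAMOND's own count:

* `chain_le_of_levelMajorGauge` — **every dominant chain with distinct consecutive terms that is certified column-wise by one level-major
  gauge has `n ≤ m·(m+2) = m² + 2m`**, for every design (dense supports included), every `m`.  DIAMOND (`…TropicalShiftDiamond*`: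
  `T(m,4) ≥ m² + 2m`, certified by such a gauge) shows the constant is attained: no design sharing DIAMOND's gauge type beats DIAMOND, and a
  «quadratic-plus» family (`n ≥ (m+1)²`, lead docket R2208) must leave the level-major single-gauge class.

PROOF (a per-column potential).  Rank the rows by the gauge, `ρ(i) = #{x : α x > α i}` (an explicit cardinality — the file introduces no definitions), and weigh an incidence of row `i` by
`ψ(i,0) = m+2`, `ψ(i,1) = m+1−ρ(i)`, `ψ(i,2) = m−ρ(i)`, `ψ(i,3) = 0`; put `Φ_k = Σ_j ψ(incidence of column j at time k)`.  Certification at the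
two times `θ_k < θ_{k+1}` makes each column's gauged slope non-decreasing (`gslope_mono`), and the level-major hypotheses make the gauged slope
injective on incidence types (`gslope_inj`), so a changed incidence has a strictly larger gauged slope; a case analysis over the `4 × 4` class
pairs (`psi_drop`) shows that `ψ` never increases along a column and drops by `≥ 1` unless the column moved to a row of strictly smaller `α`;
since the rows form a permutation before and after, some changed column did not decrease its `α` (`exists_nondecreasing_column`), so
`Φ_{k+1} ≤ Φ_k − 1`; `0 ≤ Φ ≤ m(m+2)`.  [this seat; the located companion memo SINGLE-GAUGE-CEILING-g11 (evidence on the item) records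
that `m² + 2m` is the maximum over ALL gauges for `m ≤ 4` by exhaustive computation — not claimed here.]
-/

set_option linter.dupNamespace false
set_option autoImplicit false

namespace Summit.ValiantsHypothesis.ValiantsHypothesis.Theorems.KPlusLogSqLaw

open Summit.ValiantsHypothesis.ValiantsHypothesis.Theorems.MatrixDescartes.Negative
open scoped BigOperators
open Finset

namespace SingleGauge

variable {m : ℕ}

/-! ## 1. The rank of a row in gauge order (no new definitions: the rank is the explicit cardinality below) -/

/-- the rank `#{x : α i < α x}` is at most `m − 1`. [folklore] -/
theorem rankCard_lt (α : Fin m → ℚ) (i : Fin m) : (((univ.filter fun x => α i < α x).card : ℕ) : ℤ) + 1 ≤ (m : ℤ) := by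
  have hsub : (univ.filter fun x => α i < α x) ⊆ univ.erase i := by
    intro x hx
    rw [mem_filter] at hx
    rw [mem_erase]
    exact ⟨fun h => by rw [h] at hx; exact lt_irrefl _ hx.2, mem_univ _⟩
  have h1 := card_le_card hsub
  rw [card_erase_of_mem (mem_univ i), card_univ, Fintype.card_fin] at h1
  have hm : 1 ≤ m := Nat.succ_le_of_lt (Fin.pos i)
  omega

/-- a row with smaller `α` has strictly larger rank. [folklore] -/
theorem rankCard_lt_rankCard (α : Fin m → ℚ) {i i' : Fin m} (h : α i' < α i) :
    (((univ.filter fun x => α i < α x).card : ℕ) : ℤ) + 1 ≤ (((univ.filter fun x => α i' < α x).card : ℕ) : ℤ) := by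
  have hss : (univ.filter fun x => α i < α x) ⊂ (univ.filter fun x => α i' < α x) := by
    rw [ssubset_iff_of_subset]
    · refine ⟨i, ?_, ?_⟩
      · rw [mem_filter]; exact ⟨mem_univ _, h⟩
      · rw [mem_filter]; exact fun hh => lt_irrefl _ hh.2
    · intro x hx
      rw [mem_filter] at hx ⊢
      exact ⟨mem_univ _, h.trans hx.2⟩
  have := card_lt_card hss
  omega

/-! ## 2. Gauged slopes of a level-major gauge: injective on incidence types; monotone along a certified column -/

/-- Under a LEVEL-MAJOR gauge (class `0` block below the row-by-row block of classes `1,2` below the class-`3` block; rows separated by more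
than the lo-gap) the gauged slope `d_l − α_i` determines the incidence type `(i, l)`. -/
theorem gslope_inj {d : Fin 4 → ℕ} {α : Fin m → ℚ} (hinj : Function.Injective α)
    (h01 : ∀ i i', (d 0 : ℚ) - α i < (d 1 : ℚ) - α i') (h12 : (d 1 : ℚ) < (d 2 : ℚ))
    (h23 : ∀ i i', (d 2 : ℚ) - α i < (d 3 : ℚ) - α i') (hlo : ∀ i i', α i' < α i → (d 2 : ℚ) - α i < (d 1 : ℚ) - α i')
    {i i' : Fin m} {l l' : Fin 4} (he : (d l : ℚ) - α i = (d l' : ℚ) - α i') : i = i' ∧ l = l' := by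
  have key : ∀ (a b : Fin m) (x y : Fin 4), (d x : ℚ) - α a = (d y : ℚ) - α b → x = y := by
    intro a b x y hxy
    fin_cases x <;> fin_cases y
    all_goals (first | rfl | exfalso)
    all_goals simp only [Fin.zero_eta, Fin.mk_one, Fin.reduceFinMk] at hxy
    · linarith [h01 a b]
    · linarith [h01 a b, h23 b b, show (d 1 : ℚ) - α b < (d 2 : ℚ) - α b by linarith]
    · linarith [h01 a a, h23 a b, show (d 1 : ℚ) - α a < (d 2 : ℚ) - α a by linarith]
    · linarith [h01 b a]
    · rcases lt_trichotomy (α a) (α b) with hab | hab | hab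
      · linarith [hlo b a hab]
      · rw [hab] at hxy; linarith
      · linarith [hlo a b hab]
    · linarith [h23 a b, show (d 1 : ℚ) - α a < (d 2 : ℚ) - α a by linarith]
    · linarith [h01 b a, show (d 1 : ℚ) - α a < (d 2 : ℚ) - α a by linarith]
    · rcases lt_trichotomy (α a) (α b) with hab | hab | hab
      · linarith [hlo b a hab]
      · rw [hab] at hxy; linarith
      · linarith [hlo a b hab]
    · linarith [h23 a b]
    · linarith [h01 b b, h23 b a, show (d 1 : ℚ) - α b < (d 2 : ℚ) - α b by linarith]
    · linarith [h23 b a, show (d 1 : ℚ) - α b < (d 2 : ℚ) - α b by linarith]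
    · linarith [h23 b a]
  have hl : l = l' := key i i' l l' he
  subst hl
  refine ⟨hinj ?_, rfl⟩
  linarith

/-- **Column monotonicity.**  Certification of a column at two times `t₁ < t₂` by the same gauge forces the gauged slope of its incidence at
`t₂` to be at least that at `t₁`. [folklore: upper envelopes] -/
theorem gslope_mono {d : Fin 4 → ℕ} {α : Fin m → ℚ} {t₁ t₂ : ℚ} (ht : t₁ < t₂) {i i' : Fin m} {l l' : Fin 4} {c c' : ℚ}
    (h1 : ((d l' : ℚ) - α i') * t₁ - c' ≤ ((d l : ℚ) - α i) * t₁ - c)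
    (h2 : ((d l : ℚ) - α i) * t₂ - c ≤ ((d l' : ℚ) - α i') * t₂ - c') :
    (d l : ℚ) - α i ≤ (d l' : ℚ) - α i' := by
  nlinarith

/-! ## 3. The per-incidence weight never increases along a column, and drops unless the row's `α` decreased -/

/-- **Per-column drop** for any weight `P` of the shape `(m+2 | m+1−R, m−R | 0)` with `R` a rank function of the gauge: if the gauged slope
strictly increases from incidence type `(i,l)` to `(i',l')`, then `P` does not increase, and it drops by `≥ 1` unless `α i' < α i`. -/
theorem psi_drop {d : Fin 4 → ℕ} {α : Fin m → ℚ}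
    (h01 : ∀ i i', (d 0 : ℚ) - α i < (d 1 : ℚ) - α i') (h12 : (d 1 : ℚ) < (d 2 : ℚ))
    (h23 : ∀ i i', (d 2 : ℚ) - α i < (d 3 : ℚ) - α i') (hlo : ∀ i i', α i' < α i → (d 2 : ℚ) - α i < (d 1 : ℚ) - α i')
    (R : Fin m → ℤ) (hRnn : ∀ i, 0 ≤ R i) (hRlt : ∀ i, R i + 1 ≤ (m : ℤ)) (hRup : ∀ i i', α i' < α i → R i + 1 ≤ R i')
    (hReq : ∀ i i', α i = α i' → R i = R i')
    (P : Fin m → Fin 4 → ℤ) (hP0 : ∀ i, P i 0 = (m : ℤ) + 2) (hP1 : ∀ i, P i 1 = (m : ℤ) + 1 - R i)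
    (hP2 : ∀ i, P i 2 = (m : ℤ) - R i) (hP3 : ∀ i, P i 3 = 0)
    {i i' : Fin m} {l l' : Fin 4} (hlt : (d l : ℚ) - α i < (d l' : ℚ) - α i') :
    P i' l' ≤ P i l ∧ (α i ≤ α i' → P i' l' + 1 ≤ P i l) := by
  have hr1 := hRlt i; have hr2 := hRnn i; have hr1' := hRlt i'; have hr2' := hRnn i'
  have q0 := hP0 i; have q1 := hP1 i; have q2 := hP2 i; have q3 := hP3 i
  have q0' := hP0 i'; have q1' := hP1 i'; have q2' := hP2 i'; have q3' := hP3 i'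
  fin_cases l <;> fin_cases l'
  all_goals simp only [Fin.zero_eta, Fin.mk_one, Fin.reduceFinMk, Fin.isValue] at hlt ⊢
  -- (0,0): α i' < α i
  · rw [q0, q0']; refine ⟨le_rfl, fun hle => ?_⟩; exfalso; linarith
  -- (0,1) (0,2) (0,3)
  · rw [q0, q1']; exact ⟨by omega, fun _ => by omega⟩
  · rw [q0, q2']; exact ⟨by omega, fun _ => by omega⟩
  · rw [q0, q3']; exact ⟨by omega, fun _ => by omega⟩
  -- (1,0): impossible
  · exfalso; linarith [h01 i' i]
  -- (1,1): α i' < α i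
  · have hh : α i' < α i := by linarith
    have := hRup i i' hh
    rw [q1, q1']; exact ⟨by omega, fun _ => by omega⟩
  -- (1,2)
  · rcases lt_trichotomy (α i) (α i') with hab | hab | hab
    · exfalso; linarith [hlo i' i hab]
    · have := hReq i i' hab; rw [q1, q2']; exact ⟨by omega, fun _ => by omega⟩
    · have := hRup i i' hab; rw [q1, q2']; exact ⟨by omega, fun _ => by omega⟩
  -- (1,3)
  · rw [q1, q3']; exact ⟨by omega, fun _ => by omega⟩
  -- (2,0): impossible
  · exfalso; linarith [h01 i' i, show (d 1 : ℚ) - α i < (d 2 : ℚ) - α i by linarith]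
  -- (2,1): forces α i' < α i
  · rcases lt_trichotomy (α i) (α i') with hab | hab | hab
    · exfalso; have := hlo i' i hab; linarith
    · exfalso; rw [hab] at hlt; linarith
    · have := hRup i i' hab
      rw [q2, q1']; exact ⟨by omega, fun hle => absurd hle (not_le.mpr hab)⟩
  -- (2,2): α i' < α i
  · have hh : α i' < α i := by linarith
    have := hRup i i' hh
    rw [q2, q2']; exact ⟨by omega, fun _ => by omega⟩
  -- (2,3)
  · rw [q2, q3']; exact ⟨by omega, fun _ => by omega⟩
  -- (3,0),(3,1),(3,2): impossible
  · exfalso; linarith [h01 i' i', h23 i' i, show (d 1 : ℚ) - α i' < (d 2 : ℚ) - α i' by linarith]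
  · exfalso; linarith [h23 i' i, show (d 1 : ℚ) - α i' < (d 2 : ℚ) - α i' by linarith]
  · exfalso; linarith [h23 i' i]
  -- (3,3): α i' < α i
  · rw [q3, q3']; refine ⟨le_rfl, fun hle => ?_⟩; exfalso; linarith

/-! ## 4. The theorem -/

/-- every factor of a non-zero term sign is non-zero: the incidences of a dominant term are present. -/
theorem eps_ne_zero_of_isDominant {K : ℕ} {d : Fin K → ℕ} {v ε : Fin m → Fin m → Fin K → ℤ} {θ : ℤ}
    {q : Equiv.Perm (Fin m) × (Fin m → Fin K)} (hq : IsDominant d v ε θ q) (j : Fin m) : ε (q.1 j) j (q.2 j) ≠ 0 := by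
  have h := hq.1
  unfold termSign at h
  intro hz
  apply h
  rw [mul_eq_zero]; right
  exact prod_eq_zero (mem_univ j) hz

/-- **SINGLE-GAUGE CEILING, LEVEL-MAJOR CASE.**  A dominant chain (`K = 4`) with distinct consecutive terms, certified column-wise at every
time by ONE affine row gauge `u_i(θ) = α_i θ + β_i` (hypothesis `hcert`, verbatim the hypothesis of `chain_le_of_singleGauge`) that is
LEVEL-MAJOR — `α` injective; every class-`0` gauged slope below every class-`1` one (`h01`); `d 1 < d 2` (`h12`); every class-`2` gauged slope
below every class-`3` one (`h23`); and inside the middle block the lo-gap is smaller than the gauge gaps (`hlo`) — has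
`n ≤ m(m+2) = m² + 2m`: DIAMOND's count (DIAMOND's gauge `u_a = −κθa`, `d = (0, D, D+1, 2D)`, `D = mκ`, `κ > 1` is of this type), versus
`m(4m−1)` from the general single-gauge law. [this seat; rank potential `(m+2 | m+1−ρ, m−ρ | 0)`] -/
theorem chain_le_of_levelMajorGauge (d : Fin 4 → ℕ) (v ε : Fin m → Fin m → Fin 4 → ℤ) (α β : Fin m → ℚ)
    (hinj : Function.Injective α) (h01 : ∀ i i', (d 0 : ℚ) - α i < (d 1 : ℚ) - α i') (h12 : (d 1 : ℚ) < (d 2 : ℚ))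
    (h23 : ∀ i i', (d 2 : ℚ) - α i < (d 3 : ℚ) - α i') (hlo : ∀ i i', α i' < α i → (d 2 : ℚ) - α i < (d 1 : ℚ) - α i')
    {n : ℕ} (θ : Fin (n + 1) → ℤ) (hθ : StrictMono θ) (p : Fin (n + 1) → Equiv.Perm (Fin m) × (Fin m → Fin 4))
    (hdom : ∀ k, IsDominant d v ε (θ k) (p k)) (hne : ∀ k : Fin n, p k.castSucc ≠ p k.succ)
    (hcert : ∀ (k : Fin (n + 1)) (j i : Fin m) (l : Fin 4), ε i j l ≠ 0 →
      ((θ k : ℚ) * (d l : ℚ) - (v i j l : ℚ)) - (α i * (θ k : ℚ) + β i) ≤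
        ((θ k : ℚ) * (d ((p k).2 j) : ℚ) - (v ((p k).1 j) j ((p k).2 j) : ℚ)) - (α ((p k).1 j) * (θ k : ℚ) + β ((p k).1 j))) :
    n ≤ m * (m + 2) := by
  -- rank and weight (local abbreviations only)
  let R : Fin m → ℤ := fun i => (((univ.filter fun x => α i < α x).card : ℕ) : ℤ)
  let P : Fin m → Fin 4 → ℤ := fun i l =>
    if l = 0 then (m : ℤ) + 2 else if l = 1 then (m : ℤ) + 1 - R i else if l = 2 then (m : ℤ) - R i else 0
  have hRnn : ∀ i, 0 ≤ R i := fun i => by positivity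
  have hRlt : ∀ i, R i + 1 ≤ (m : ℤ) := fun i => rankCard_lt α i
  have hRup : ∀ i i', α i' < α i → R i + 1 ≤ R i' := fun i i' h => rankCard_lt_rankCard α h
  have hReq : ∀ i i', α i = α i' → R i = R i' := fun i i' h => by simp only [R, h]
  have hP0 : ∀ i, P i 0 = (m : ℤ) + 2 := fun i => by simp [P]
  have hP1 : ∀ i, P i 1 = (m : ℤ) + 1 - R i := fun i => by simp [P]
  have hP2 : ∀ i, P i 2 = (m : ℤ) - R i := fun i => by simp [P]
  have hP3 : ∀ i, P i 3 = 0 := fun i => by simp [P]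
  have hPnn : ∀ i l, 0 ≤ P i l := by
    intro i l; have := hRnn i; have := hRlt i
    simp only [P]
    split_ifs <;> omega
  have hPle : ∀ i l, P i l ≤ (m : ℤ) + 2 := by
    intro i l; have := hRnn i
    simp only [P]
    split_ifs <;> omega
  -- the potential
  let Φ : Fin (n + 1) → ℤ := fun k => ∑ j, P ((p k).1 j) ((p k).2 j)
  -- one step
  have hstep : ∀ k : Fin n, Φ k.succ + 1 ≤ Φ k.castSucc := by
    intro k
    set a := k.castSucc with ha
    set b := k.succ with hb
    have hab : θ a < θ b := hθ (Fin.castSucc_lt_succ (i := k))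
    have habQ : (θ a : ℚ) < (θ b : ℚ) := by exact_mod_cast hab
    -- per column: gauged slope non-decreasing, strictly increasing when the incidence changed
    have hcol : ∀ j, P ((p b).1 j) ((p b).2 j) ≤ P ((p a).1 j) ((p a).2 j) ∧
        (((p a).1 j ≠ (p b).1 j ∨ (p a).2 j ≠ (p b).2 j) → α ((p a).1 j) ≤ α ((p b).1 j) →
          P ((p b).1 j) ((p b).2 j) + 1 ≤ P ((p a).1 j) ((p a).2 j)) := by
      intro j
      have e1 := eps_ne_zero_of_isDominant (hdom a) j
      have e2 := eps_ne_zero_of_isDominant (hdom b) j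
      have c1 := hcert a j ((p b).1 j) ((p b).2 j) e2
      have c2 := hcert b j ((p a).1 j) ((p a).2 j) e1
      have hmono : (d ((p a).2 j) : ℚ) - α ((p a).1 j) ≤ (d ((p b).2 j) : ℚ) - α ((p b).1 j) :=
        gslope_mono habQ (c := (v ((p a).1 j) j ((p a).2 j) : ℚ) + β ((p a).1 j))
          (c' := (v ((p b).1 j) j ((p b).2 j) : ℚ) + β ((p b).1 j)) (by linarith) (by linarith)
      by_cases hch : (p a).1 j ≠ (p b).1 j ∨ (p a).2 j ≠ (p b).2 j
      · have hlt : (d ((p a).2 j) : ℚ) - α ((p a).1 j) < (d ((p b).2 j) : ℚ) - α ((p b).1 j) := by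
          refine lt_of_le_of_ne hmono fun heq => ?_
          obtain ⟨h1, h2⟩ := gslope_inj hinj h01 h12 h23 hlo heq
          rcases hch with h | h
          · exact h h1
          · exact h h2
        obtain ⟨d0, d1⟩ := psi_drop h01 h12 h23 hlo R hRnn hRlt hRup hReq P hP0 hP1 hP2 hP3 hlt
        exact ⟨d0, fun _ hle => d1 hle⟩
      · push Not at hch
        obtain ⟨h1, h2⟩ := hch
        rw [h1, h2]
        exact ⟨le_rfl, fun hc _ => by rcases hc with hc | hc <;> exact absurd rfl hc⟩
    -- some changed column did not decrease its α (the rows are a permutation before and after)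
    have hex : ∃ j, ((p a).1 j ≠ (p b).1 j ∨ (p a).2 j ≠ (p b).2 j) ∧ α ((p a).1 j) ≤ α ((p b).1 j) := by
      by_cases hrow : ∃ j, (p a).1 j ≠ (p b).1 j
      · have hsum : ∑ j, α ((p a).1 j) = ∑ j, α ((p b).1 j) := by
          rw [Equiv.sum_comp (p a).1 α, Equiv.sum_comp (p b).1 α]
        by_contra hcon
        push Not at hcon
        have hle : ∀ j, α ((p b).1 j) ≤ α ((p a).1 j) := by
          intro j
          by_cases hj : (p a).1 j = (p b).1 j
          · rw [hj]
          · exact (hcon j (Or.inl hj)).le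
        obtain ⟨j0, hj0⟩ := hrow
        have hlt0 : α ((p b).1 j0) < α ((p a).1 j0) := hcon j0 (Or.inl hj0)
        have : ∑ j, α ((p b).1 j) < ∑ j, α ((p a).1 j) :=
          sum_lt_sum (fun j _ => hle j) ⟨j0, mem_univ _, hlt0⟩
        linarith
      · push Not at hrow
        have hperm : (p a).1 = (p b).1 := Equiv.ext hrow
        have hcls : (p a).2 ≠ (p b).2 := by
          intro hc
          exact hne k (Prod.ext hperm hc)
        obtain ⟨j, hj⟩ := Function.ne_iff.mp hcls
        exact ⟨j, Or.inr hj, by rw [hrow j]⟩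
    obtain ⟨j0, hj0c, hj0a⟩ := hex
    have h0 : P ((p b).1 j0) ((p b).2 j0) + 1 ≤ P ((p a).1 j0) ((p a).2 j0) := (hcol j0).2 hj0c hj0a
    have hdiff : Φ a - Φ b = ∑ j, (P ((p a).1 j) ((p a).2 j) - P ((p b).1 j) ((p b).2 j)) := by
      simp only [Φ, sum_sub_distrib]
    have hge : (P ((p a).1 j0) ((p a).2 j0) - P ((p b).1 j0) ((p b).2 j0)) ≤
        ∑ j, (P ((p a).1 j) ((p a).2 j) - P ((p b).1 j) ((p b).2 j)) :=
      single_le_sum (f := fun j => P ((p a).1 j) ((p a).2 j) - P ((p b).1 j) ((p b).2 j))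
        (fun j _ => by linarith [(hcol j).1]) (mem_univ j0)
    linarith
  -- telescope
  have htel : ∀ k : Fin (n + 1), Φ k + (k : ℤ) ≤ Φ 0 := by
    intro k
    induction k using Fin.induction with
    | zero => simp
    | succ k ih =>
      have := hstep k
      have hv : ((k.succ : Fin (n + 1)) : ℤ) = ((k.castSucc : Fin (n + 1)) : ℤ) + 1 := by
        simp [Fin.val_succ]
      rw [hv]; linarith
  have hlast := htel (Fin.last n)
  have h0 : Φ 0 ≤ (m : ℤ) * ((m : ℤ) + 2) := by
    calc Φ 0 = ∑ j, P ((p 0).1 j) ((p 0).2 j) := rfl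
      _ ≤ ∑ _j : Fin m, ((m : ℤ) + 2) := sum_le_sum fun j _ => hPle _ _
      _ = (m : ℤ) * ((m : ℤ) + 2) := by rw [sum_const, card_univ, Fintype.card_fin]; ring
  have hnn : 0 ≤ Φ (Fin.last n) := sum_nonneg fun j _ => hPnn _ _
  have hl : ((Fin.last n : Fin (n + 1)) : ℤ) = n := by simp
  rw [hl] at hlast
  have : (n : ℤ) ≤ (m : ℤ) * ((m : ℤ) + 2) := by linarith
  exact_mod_cast this

end SingleGauge

end Summit.ValiantsHypothesis.ValiantsHypothesis.Theorems.KPlusLogSqLaw
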